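import Mathlib.Topology.ContinuousMap.CompactlySupported
import Mathlib.Topology.ContinuousMap.Bounded.Basic
import Mathlib.MeasureTheory.Integral.Bochner.Basic
import Literature.Analysis.FunctionSpaces.PointConfigKernel
import HarnessLib

/-!
# The vague (local) topology on point configurations and the local weak topology on their laws

Topic `Literature/Analysis/FunctionSpaces` (next to `PoissonPointProcess`, `PointConfigKernel`); part (a)
of the definition request `defn-PalmLocalState` (route `PesinPricing`, crux `KiferYoungUpperR`,
`Summits/AtomisticToContinuum/HydrodynamicLimit`): a topology in which "weakly closed sets `𝒜` of
laws of local states", cluster points and `limsup` statements about laws on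
`PointConfig (ℝᵈ × ℝᵈ)` elaborate.

## Contents

* `PointConfig.sumFn ω f = ∑_{p ∈ ω} f p` (a finitely supported sum `∑ᶠ`, the "linear statistic"
  `ω f = ∫ f dω` of Kallenberg; finite for `f` with compact support since `ω` is locally finite);
* `PointConfig.instTopologicalSpace`: the VAGUE TOPOLOGY on `PointConfig X` — the coarsest topology
  making `ω ↦ ∑_{p ∈ ω} f p` continuous for every continuous compactly supported `f : X → ℝ`
  (Kallenberg, *Foundations*, Thm. A2.3 and Ch. 16: "the vague topology in `𝓜(S)` is generated by the
  maps `π_f`, `f ∈ C_K⁺`"; Daley–Vere-Jones II §9.1, A2.3); `tendsto_nhds_iff`: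
  `ω_k → ω` iff `∑_{p ∈ ω_k} f p → ∑_{p ∈ ω} f p` for all `f ∈ C_c(X, ℝ)`; `continuous_sumFn`;
* `PointConfig.localWeakTopology`: the weak topology on `Measure (PointConfig X)` induced by the vague
  topology — the coarsest topology making `μ ↦ ∫ F dμ` continuous for every bounded vaguely
  continuous `F : PointConfig X → ℝ` (convergence in distribution of point processes, Kallenberg
  Thm. 16.16; Daley–Vere-Jones II §11.1). It is a `def`, NOT an instance (see Design); use it as
  `IsClosed[PointConfig.localWeakTopology] 𝒜` (Mathlib's scoped `Topology` notation), or through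
  `PointConfig.IsLocalWeakClosed 𝒜`, `PointConfig.IsLocalWeakClusterPt μ Q`,
  `PointConfig.tendsto_localWeak_iff`;
* `PointConfig.IsLocalOn s F`: `F` depends only on the configuration in `s` (`F (ω ∩ s) = F ω`);
* `PointConfig.measurable_translate_prod`: `(v, ω) ↦ ω + v` is jointly measurable (Last–Penrose
  2017 Lemma 9.2), the input for push-forward definitions of Palm laws (`PalmLocalState`).

## How the marks enter ("local" functionals of marked configurations)

For the hard-sphere gas `X = ℝᵈ × ℝᵈ` (position, velocity) and `PointConfig X` asks finiteness on
compact subsets of PHASE space only. Vague test functions `f ∈ C_c(ℝᵈ × ℝᵈ)` are compactly supported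
in the velocity as well, so vague convergence `ω_k → ω` is convergence of the configuration seen in
every bounded window of positions AND velocities: particles whose velocity escapes to infinity
disappear in the limit (kinetic energy is NOT a vaguely continuous functional — uniform
integrability of `|v|²` has to be supplied separately, as in Olla–Varadhan–Yau 1993 Lemma 4.1). A
functional `F` of configurations is LOCAL when it depends only on the configuration in a bounded
spatial window `Λ`, `F ω = F (ω ∩ (Λ × ℝᵈ))` (`IsLocalOn (Prod.fst ⁻¹' Λ) F`); the "local weak"
test functionals of the route are the bounded vaguely continuous local `F`. Restricting the index
set of `localWeakTopology` to local `F` gives a coarser (or equal) topology, so every set closed for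
it is closed here; we index by ALL bounded continuous `F` (the weak topology of the vague topology,
the canonical choice). Georgii–Zessin (1993, §2.1) use two finer topologies: `τ_Ω` on configurations
(test functions bounded continuous with spatially bounded support — finite sums only on
configurations locally finite in the position coordinate, e.g. hard-core ones) and the topology
`τ_𝓛` of local convergence on laws (test functionals bounded — even "tame" — and merely MEASURABLE
with respect to a bounded window); `τ_𝓛`-l.s.c./closedness statements are stronger than local weak
ones. Neither is defined here (remark only, as requested).

## Design

* The vague topology is an `instance` on the tree's own type `PointConfig X` (no Mathlib type is
  touched). On `Measure (PointConfig X)` we do NOT register an instance: Mathlib equips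
  `ProbabilityMeasure Ω` / `FiniteMeasure Ω` with the weak topology only under
  `[OpensMeasurableSpace Ω]`, i.e. here: every vaguely open set is in the count σ-algebra. This is
  true (the Borel σ-algebra of the vague topology IS the count σ-algebra on an lcscH space,
  Kallenberg Thm. A2.3 (iv); Daley–Vere-Jones II Thm. 9.1.IV) but not proved in the tree; once it is,
  `ProbabilityMeasure (PointConfig X)` carries Mathlib's instance, which agrees with
  `localWeakTopology` restricted to probability laws. Until then statements are written with the
  explicit topology `localWeakTopology` (a `def`), which avoids any future instance clash.
* `∫ F dμ` is Mathlib's Bochner integral; mathematically every bounded vaguely continuous `F` is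
  count-measurable (previous item), so no junk value is involved, but this is not proved here.
* Deliberately NOT here: metrisability / Polishness of the vague topology (Kallenberg Thm. A2.3 (i)),
  relative compactness criteria (A2.3 (ii)), the identification of vague cluster points with the
  Laplace-functional cluster points `PointProcess.IsVagueClusterPoint` of
  `Literature/MathematicalPhysics/KineticTheory/RegularStationaryState.lean` (Kallenberg Thm. 16.16),
  and `BorelSpace (PointConfig X)`.

## References

* O. Kallenberg, *Foundations of Modern Probability* (held copy `book:kallenberg2021-…`), Thm. A2.3
  (vague topology), Lemma 16.15–Thm. 16.16 (convergence of random measures).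
* D. J. Daley, D. Vere-Jones, *An Introduction to the Theory of Point Processes* II (2008), §9.1,
  §11.1, A2.3. [II2008]
* H.-O. Georgii, H. Zessin, *Large deviations and the maximum entropy principle for marked point
  random fields*, PTRF 96 (1993), §2.1 (topologies `τ_Ω`, `τ_𝓛`).
* G. Last, M. Penrose, *Lectures on the Poisson Process* (2017), Lemma 9.2.
-/

noncomputable section

open MeasureTheory Set Filter Topology Function
open scoped ENNReal CompactlySupported BoundedContinuousFunction

namespace Literature.Analysis.FunctionSpaces

namespace PointConfig

variable {X : Type*} [TopologicalSpace X]

/-! ## Linear statistics `∑_{p ∈ ω} f p` -/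

/-- The sum `∑_{p ∈ ω} f p` of a real test function over the points of a configuration (the linear
statistic `ω f = ∫ f dω` of `ω` viewed as a counting measure; a finitely supported sum `∑ᶠ`, which
is the honest finite sum whenever only finitely many points of `ω` lie in the support of `f`, e.g.
for `f` of compact support, `sumFn_eq_sum`). [cite: Kallenberg2021, Thm. A2.3] -/
def sumFn (ω : PointConfig X) (f : X → ℝ) : ℝ :=
  ∑ᶠ p ∈ (ω : Set X), f p

/-- Unfolding `sumFn`. [folklore] -/
theorem sumFn_def (ω : PointConfig X) (f : X → ℝ) : ω.sumFn f = ∑ᶠ p ∈ (ω : Set X), f p := rfl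

/-- Only finitely many points of a configuration lie in the support of a compactly supported
function. [folklore] -/
theorem finite_inter_support (ω : PointConfig X) {f : X → ℝ} (hf : HasCompactSupport f) :
    ((ω : Set X) ∩ support f).Finite :=
  (ω.finite_inter_isCompact _ hf.isCompact).subset (inter_subset_inter_right _ (subset_tsupport f))

/-- For compactly supported `f` the linear statistic is a finite sum over the points in the
support. [folklore] -/
theorem sumFn_eq_sum (ω : PointConfig X) {f : X → ℝ} (hf : HasCompactSupport f) :
    ω.sumFn f = ∑ p ∈ (ω.finite_inter_support hf).toFinset, f p :=
  finsum_mem_eq_sum f (ω.finite_inter_support hf)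

/-- The empty configuration has vanishing linear statistics. [folklore] -/
@[simp]
theorem sumFn_empty (f : X → ℝ) : (∅ : PointConfig X).sumFn f = 0 := by
  rw [sumFn_def]
  simp

/-- The linear statistic of `0` vanishes. [folklore] -/
@[simp]
theorem sumFn_zero (ω : PointConfig X) : ω.sumFn (fun _ => 0) = 0 := by
  rw [sumFn_def]
  exact finsum_mem_of_eqOn_zero fun _ _ => rfl

/-- Additivity of linear statistics for compactly supported test functions. [folklore] -/
theorem sumFn_add (ω : PointConfig X) {f g : X → ℝ} (hf : HasCompactSupport f)
    (hg : HasCompactSupport g) : ω.sumFn (f + g) = ω.sumFn f + ω.sumFn g := by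
  show ∑ᶠ p ∈ (ω : Set X), (f p + g p) = _
  exact finsum_mem_add_distrib' (ω.finite_inter_support hf) (ω.finite_inter_support hg)

/-- Linear statistics of nonnegative test functions are nonnegative. [folklore] -/
theorem sumFn_nonneg (ω : PointConfig X) {f : X → ℝ} (hf : ∀ x, 0 ≤ f x) : 0 ≤ ω.sumFn f :=
  finsum_nonneg fun x => finsum_nonneg fun _ => hf x

/-! ## The vague topology -/

/-- **The vague topology** on locally finite configurations: the coarsest topology for which every
linear statistic `ω ↦ ∑_{p ∈ ω} f p`, `f : X → ℝ` continuous with compact support, is continuous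
(Kallenberg, Thm. A2.3: "the vague topology in `𝓜(S)` is generated by the maps `π_f`, `f ∈ C_K⁺`";
generating by `C_K⁺` or by all of `C_c(X, ℝ)` gives the same topology, `f = f⁺ - f⁻`). For
`X = ℝᵈ × ℝᵈ` this is the local topology of configurations seen in bounded windows of phase
space (module docstring). [cite: Kallenberg2021, Thm. A2.3] -/
instance instTopologicalSpace : TopologicalSpace (PointConfig X) :=
  ⨅ f : C_c(X, ℝ), TopologicalSpace.induced (fun ω : PointConfig X => ω.sumFn f) inferInstance

/-- The vague topology is the infimum of the topologies induced by the linear statistics of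
compactly supported continuous functions. [cite: Kallenberg2021, Thm. A2.3] -/
theorem vagueTopology_eq :
    (instTopologicalSpace : TopologicalSpace (PointConfig X)) =
      ⨅ f : C_c(X, ℝ), TopologicalSpace.induced (fun ω : PointConfig X => ω.sumFn f) inferInstance :=
  rfl

/-- Linear statistics of compactly supported continuous functions are vaguely continuous
(by definition of the vague topology). [cite: Kallenberg2021, Thm. A2.3] -/
@[fun_prop]
theorem continuous_sumFn (f : C_c(X, ℝ)) : Continuous fun ω : PointConfig X => ω.sumFn f :=
  continuous_iInf_dom (t₁ := fun g : C_c(X, ℝ) =>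
    TopologicalSpace.induced (fun ω : PointConfig X => ω.sumFn g) inferInstance) (i := f)
    continuous_induced_dom

/-- Unbundled form of `continuous_sumFn`. [folklore] -/
theorem continuous_sumFn' {f : X → ℝ} (hf : Continuous f) (hcs : HasCompactSupport f) :
    Continuous fun ω : PointConfig X => ω.sumFn f :=
  continuous_sumFn ⟨⟨f, hf⟩, hcs⟩

/-- Neighbourhood filters of the vague topology. [folklore] -/
theorem nhds_eq (ω : PointConfig X) :
    𝓝 ω = ⨅ f : C_c(X, ℝ), comap (fun ω' : PointConfig X => ω'.sumFn f) (𝓝 (ω.sumFn f)) := by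
  rw [vagueTopology_eq, nhds_iInf]
  simp only [nhds_induced]

/-- **Vague convergence**: `ω_k → ω` iff `∑_{p ∈ ω_k} f p → ∑_{p ∈ ω} f p` for every continuous
compactly supported `f` (Kallenberg Thm. A2.3; Daley–Vere-Jones II A2.3). [cite: Kallenberg2021, Thm. A2.3] -/
theorem tendsto_nhds_iff {ι : Type*} {l : Filter ι} {u : ι → PointConfig X} {ω : PointConfig X} :
    Tendsto u l (𝓝 ω) ↔
      ∀ f : C_c(X, ℝ), Tendsto (fun i => (u i).sumFn f) l (𝓝 (ω.sumFn f)) := by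
  rw [nhds_eq, tendsto_iInf]
  simp only [tendsto_comap_iff, Function.comp_def]

/-- A map into configurations is vaguely continuous iff all its linear statistics are. [folklore] -/
theorem continuous_rng_iff {Y : Type*} [TopologicalSpace Y] {g : Y → PointConfig X} :
    Continuous g ↔ ∀ f : C_c(X, ℝ), Continuous fun y => (g y).sumFn f := by
  rw [vagueTopology_eq, continuous_iInf_rng]
  simp only [continuous_induced_rng, Function.comp_def]

/-! ## Local functionals -/

/-- `F` is LOCAL ON `s`: it depends only on the configuration inside `s`, `F (ω ∩ s) = F ω` (for
marked configurations `s = Λ × M`, a bounded spatial window `Λ` with arbitrary marks: Georgii–Zessin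
1993 §2.1, "`f` is local if it is `𝓕_Λ`-measurable for some bounded `Λ`"). [cite: GeorgiiZessin1993, §2.1] -/
def IsLocalOn {α : Sort*} (s : Set X) (F : PointConfig X → α) : Prop :=
  ∀ ω : PointConfig X, F (ω.restrict s) = F ω

/-- A functional local on `s` is local on every larger set. [folklore] -/
theorem IsLocalOn.mono {α : Sort*} {s t : Set X} {F : PointConfig X → α} (h : IsLocalOn s F)
    (hst : s ⊆ t) : IsLocalOn t F := by
  intro ω
  have h2 : (ω.restrict t).restrict s = ω.restrict s := by
    ext p
    change p ∈ (ω.carrier ∩ t) ∩ s ↔ p ∈ ω.carrier ∩ s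
    exact ⟨fun hp => ⟨hp.1.1, hp.2⟩, fun hp => ⟨⟨hp.1, hst hp.2⟩, hp.2⟩⟩
  rw [← h (ω.restrict t), h2, h ω]

/-- Constant functionals are local on every set. [folklore] -/
theorem isLocalOn_const {α : Sort*} (s : Set X) (a : α) : IsLocalOn s (fun _ : PointConfig X => a) :=
  fun _ => rfl

/-! ## The local weak topology on laws of configurations -/

section Laws

variable [MeasurableSpace X]

/-- **The local weak topology** on laws of configurations: the weak topology induced by the vague
topology, i.e. the coarsest topology on `Measure (PointConfig X)` making `μ ↦ ∫ F dμ` continuous for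
every bounded vaguely continuous `F : PointConfig X → ℝ` (convergence in distribution of point
processes / random measures with respect to the vague topology: Kallenberg Thm. 16.16;
Daley–Vere-Jones II §11.1). A `def`, not an instance: write `IsClosed[PointConfig.localWeakTopology] 𝒜`,
or use `IsLocalWeakClosed`, `IsLocalWeakClusterPt`, `tendsto_localWeak_iff`. See the module docstring
for local test functionals and for Georgii–Zessin's finer `τ_𝓛`. (Reducible, as Lean requires of
definitions of class type that are used as explicit instances.) [cite: Kallenberg2021, Thm. 16.16] -/
@[reducible]
def localWeakTopology : TopologicalSpace (Measure (PointConfig X)) :=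
  ⨅ F : PointConfig X →ᵇ ℝ,
    TopologicalSpace.induced (fun μ : Measure (PointConfig X) => ∫ ω, F ω ∂μ) inferInstance

/-- Unfolding `localWeakTopology`. [folklore] -/
theorem localWeakTopology_eq :
    (localWeakTopology : TopologicalSpace (Measure (PointConfig X))) =
      ⨅ F : PointConfig X →ᵇ ℝ,
        TopologicalSpace.induced (fun μ : Measure (PointConfig X) => ∫ ω, F ω ∂μ) inferInstance :=
  rfl

/-- Expectations of bounded vaguely continuous functionals are continuous for the local weak
topology (by definition). [cite: Kallenberg2021, Thm. 16.16] -/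
theorem continuous_integral_localWeak (F : PointConfig X →ᵇ ℝ) :
    Continuous[localWeakTopology, inferInstance]
      fun μ : Measure (PointConfig X) => ∫ ω, F ω ∂μ :=
  continuous_iInf_dom (t₁ := fun G : PointConfig X →ᵇ ℝ =>
    TopologicalSpace.induced (fun μ : Measure (PointConfig X) => ∫ ω, G ω ∂μ) inferInstance) (i := F)
    continuous_induced_dom

/-- **Local weak convergence of laws**: `Q_i → μ` iff `∫ F dQ_i → ∫ F dμ` for every bounded vaguely
continuous `F`. [cite: Kallenberg2021, Thm. 16.16] -/
theorem tendsto_localWeak_iff {ι : Type*} {l : Filter ι} {Q : ι → Measure (PointConfig X)}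
    {μ : Measure (PointConfig X)} :
    Tendsto Q l (@nhds _ localWeakTopology μ) ↔
      ∀ F : PointConfig X →ᵇ ℝ, Tendsto (fun i => ∫ ω, F ω ∂(Q i)) l (𝓝 (∫ ω, F ω ∂μ)) := by
  rw [localWeakTopology_eq, nhds_iInf]
  simp only [nhds_induced, tendsto_iInf, tendsto_comap_iff, Function.comp_def]

/-- A set `𝒜` of laws of configurations is LOCAL-WEAKLY CLOSED (the "weakly closed `𝒜`" of
large-deviation upper bounds for laws of local states). [folklore] -/
def IsLocalWeakClosed (𝒜 : Set (Measure (PointConfig X))) : Prop :=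
  IsClosed[localWeakTopology] 𝒜

/-- Unfolding `IsLocalWeakClosed`. [folklore] -/
theorem isLocalWeakClosed_iff (𝒜 : Set (Measure (PointConfig X))) :
    IsLocalWeakClosed 𝒜 ↔ IsClosed[localWeakTopology] 𝒜 :=
  Iff.rfl

/-- The whole space is local-weakly closed. [folklore] -/
theorem isLocalWeakClosed_univ : IsLocalWeakClosed (univ : Set (Measure (PointConfig X))) := by
  letI : TopologicalSpace (Measure (PointConfig X)) := localWeakTopology
  exact isClosed_univ

/-- A local-weakly closed set contains the local weak limits of (eventually) its members.
[folklore] -/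
theorem IsLocalWeakClosed.mem_of_tendsto {𝒜 : Set (Measure (PointConfig X))}
    (h𝒜 : IsLocalWeakClosed 𝒜) {ι : Type*} {l : Filter ι} [NeBot l] {Q : ι → Measure (PointConfig X)}
    {μ : Measure (PointConfig X)} (hlim : Tendsto Q l (@nhds _ localWeakTopology μ))
    (hQ : ∀ᶠ i in l, Q i ∈ 𝒜) : μ ∈ 𝒜 := by
  letI : TopologicalSpace (Measure (PointConfig X)) := localWeakTopology
  exact IsClosed.mem_of_tendsto h𝒜 hlim hQ

/-- Sublevel sets `{μ | ∫ F dμ ≤ c}` of expectations of bounded vaguely continuous functionals are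
local-weakly closed (e.g. an energy-type constraint with a bounded continuous cut-off).
[folklore] -/
theorem isLocalWeakClosed_setOf_integral_le (F : PointConfig X →ᵇ ℝ) (c : ℝ) :
    IsLocalWeakClosed {μ : Measure (PointConfig X) | ∫ ω, F ω ∂μ ≤ c} := by
  letI : TopologicalSpace (Measure (PointConfig X)) := localWeakTopology
  exact isClosed_le (continuous_integral_localWeak F) continuous_const

/-- `μ` is a LOCAL WEAK CLUSTER POINT of the sequence of laws `Q`: a cluster point of `Q` along
`atTop` in the local weak topology (the "limit points of the laws of local states").
[cite: Kallenberg2021, Thm. 16.16] -/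
def IsLocalWeakClusterPt (μ : Measure (PointConfig X)) (Q : ℕ → Measure (PointConfig X)) : Prop :=
  @MapClusterPt _ localWeakTopology ℕ μ atTop Q

/-- A local weak limit is a local weak cluster point. [folklore] -/
theorem IsLocalWeakClusterPt.of_tendsto {μ : Measure (PointConfig X)}
    {Q : ℕ → Measure (PointConfig X)} (h : Tendsto Q atTop (@nhds _ localWeakTopology μ)) :
    IsLocalWeakClusterPt μ Q := by
  letI : TopologicalSpace (Measure (PointConfig X)) := localWeakTopology
  exact h.mapClusterPt

/-- A local-weakly closed set containing the sequence contains all its local weak cluster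
points. [folklore] -/
theorem IsLocalWeakClosed.mem_of_isLocalWeakClusterPt {𝒜 : Set (Measure (PointConfig X))}
    (h𝒜 : IsLocalWeakClosed 𝒜) {μ : Measure (PointConfig X)} {Q : ℕ → Measure (PointConfig X)}
    (hμ : IsLocalWeakClusterPt μ Q) (hQ : ∀ n, Q n ∈ 𝒜) : μ ∈ 𝒜 := by
  letI : TopologicalSpace (Measure (PointConfig X)) := localWeakTopology
  have hle : map Q atTop ≤ 𝓟 𝒜 := le_principal_iff.2 (mem_map.2 (univ_mem' fun n => hQ n))
  exact isClosed_iff_clusterPt.1 h𝒜 μ ((show ClusterPt μ (map Q atTop) from hμ).mono hle)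

end Laws

/-! ## Joint measurability of translations -/

section Translate

variable {E : Type*} [TopologicalSpace E] [AddGroup E] [ContinuousAdd E] [MeasurableSpace E]
  [BorelSpace E] [T2Space E] [SigmaCompactSpace E] [MeasurableAdd₂ E]

/-- **Translation is jointly measurable**: `(v, ω) ↦ ω + v` is measurable on `E × PointConfig E`
(Last–Penrose 2017 Lemma 9.2, "the mapping `(x, μ) ↦ θ_x μ` is measurable"): the counting maps of
the translate are the parametrised counts `N_ω({x | x + v ∈ s})` of a measurable family of sets,
measurable by the s-finite counting-kernel machinery (`measurable_toMeasure_preimage`).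
[cite: LastPenrose2017, Lemma 9.2] -/
theorem measurable_translate_prod :
    Measurable fun q : E × PointConfig E => q.2.translate q.1 := by
  refine measurable_of_count fun s hs => ?_
  -- the family of sets `{(q, x) | x + q.1 ∈ s}`
  have ht : MeasurableSet {r : (E × PointConfig E) × E | r.2 + r.1.1 ∈ s} :=
    (measurable_snd.add measurable_fst.fst) hs
  have hmeas : Measurable fun q : E × PointConfig E =>
      (q.2).toMeasure (Prod.mk q ⁻¹' {r : (E × PointConfig E) × E | r.2 + r.1.1 ∈ s}) :=
    measurable_toMeasure_preimage ht measurable_snd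
  have hfun : (fun q : E × PointConfig E => (((q.2.translate q.1).count s : ℕ∞) : ℝ≥0∞)) =
      fun q : E × PointConfig E =>
        (q.2).toMeasure (Prod.mk q ⁻¹' {r : (E × PointConfig E) × E | r.2 + r.1.1 ∈ s}) := by
    funext q
    rw [count_translate, ← toMeasure_apply _ (measurable_add_const q.1 hs)]
    rfl
  refine measurable_to_countable' fun n => ?_
  have hset : (fun q : E × PointConfig E => (q.2.translate q.1).count s) ⁻¹' {n} =
      (fun q : E × PointConfig E => (((q.2.translate q.1).count s : ℕ∞) : ℝ≥0∞)) ⁻¹' {(n : ℝ≥0∞)} := by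
    ext q
    simp only [mem_preimage, mem_singleton_iff, ENat.toENNReal_inj]
  rw [hset, hfun]
  exact hmeas (measurableSet_singleton _)

/-- Translation by a measurable family of vectors of a measurable family of configurations is
measurable. [folklore] -/
theorem _root_.Measurable.pointConfig_translate {α : Type*} [MeasurableSpace α] {v : α → E}
    {g : α → PointConfig E} (hv : Measurable v) (hg : Measurable g) :
    Measurable fun a => (g a).translate (v a) :=
  measurable_translate_prod.comp (hv.prodMk hg)

end Translate

end PointConfig

end Literature.Analysis.FunctionSpaces
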